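import Summits.CriticalPhenomena.PercolationContinuityZ3.Theorems.PercNearOneGluingNoHeavyLowerTailSunflowerChainCertificateDuality
import HarnessLib
import HarnessLib.Audit

/-!
# `NoHeavyLowerTail` (crux stmt-CriticalPhenomena-4575), abstract sunflower cubic: the LOCAL ABSTRACTION of a triple — the three-block median
# certificate reduced to a finite statement about valid local data

Support file (seat `prim-ineq-prove-1` gen 33; `--supports stmt-CriticalPhenomena-4575`; companion of `…SunflowerChainCertificate` (p243463),
`…ChainCertificateStructure`, `…ChainCertificateDuality`).  No `sorry`, no named facts, nothing asserted about the crux.  Memo: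
run/shared/lean/prim/prim-ineq-prove-1/FINDING-CHAINCERT-prove1-g33.md §4.

THE ABSTRACTION.  Fix a monotone labelling `lab` of a product of three chains and a triple `t`.  An INDEX VECTOR `j : Fin 3 → Fin 3` names the
point `pt t j = (e ↦ t (j e) e)` of the box of `t`; the value-permutation action is a re-indexing, `act g t i = pt t (gidx g i)`
DEFINITIONALLY (`act_eq_pt`).  The LOCAL DATUM of `t` (`datum lab t : LocalDatum`) records, on index vectors, the bottom and kernel
indicators `Z`, `O`, the label-equality relation `E` and the transfer relation `M` (membership in `Λ_T`); the abstract kernel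
`LocalDatum.kT` is the symmetric pole-`T` kernel read through the CELL CODES `LocalDatum.cell` (`0` bottom, `1` petal, `2` kernel) and
`E`, `M`, and `LocalDatum.FlocT = Σ_{g ∈ S₃³} kT(g·0,g·1,g·2)`.
* `orbitSum_kerSym_eq_FlocT` — SOUNDNESS: the orbit sum of `kerSym 1 0 lab (mT lab)` at `t` equals `(datum lab t).FlocT` (by unfolding).
* `LocalDatum.Valid pre D` — the finitely many CONSTRAINTS relative to per-block comparison data `pre` (`preOf t e i i' ↔ t i e ≤ t i' e`):
  totality/transitivity of comparisons, consistency of `Z/O/E`, MONOTONICITY (`j ≤ j'` blockwise ⇒ `E j j' ∨ Z j ∨ O j'`), congruence of `M`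
  under equal points, and for every transfer pair `M j j'`: `Z j`, `O j'`, strict increase in every block, one-block lifts
  `update j e (j' e)` not bottom and — when petal — in pairwise distinct petals, two-block lifts `update j' e (j e)` kernel (these are
  `med_lt_join`, `lab_lift1`, `lab_lift2`, `lab_join` of the structure lemma, transported by `pt_update`), and finally `M_loc`: every LOCAL
  rainbow (three petal index vectors with pairwise distinct petals) whose blockwise median (`medIdx`, via `medSel`) is a bottom point gives the
  transfer pair (median, maximum) (`med_tri`, `join_tri`).
* `datum_valid` — the local datum of a monotone labelling at any triple is valid.
* `threeBlockMedianCertificate_of_local` — **if every valid local datum has `FlocT ≥ 0`, then `ThreeBlockMedianCertificate` holds** (pole `T`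
  by soundness + validity + `orbitSum_kerSym`; pole `B` by `threeBlockMedianCertificate_of_poleT`).
WHAT REMAINS for the kernel replay (memo §4c–4e): the finite statement `∀ pre D, D.Valid pre → 0 ≤ D.FlocT` — a verified enumeration of
(sorted comparison patterns, `Z/O` monotone pairs, `E` as set partitions) with the additivity of `FlocT` in `M` (worst case over
`M_loc ⊆ M ⊆ candidates` = g31's `X_loc`), evaluated by `native_decide` (≈ 1.5·10⁶ configurations).
-/

namespace Summit.CriticalPhenomena.PercolationContinuityZ3.Theorems.SunflowerPartition

namespace ChainCert

open Finset


section LocalAbstraction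

variable {n : Fin 3 → ℕ}

/-- Index vectors: `j e` says which of the three slots supplies the value of block `e`. [this work] -/
abbrev J : Type := Fin 3 → Fin 3

/-- The point of the box of `t` with index vector `j`. [this work] -/
def pt (t : Fin 3 → Pt n) (j : J) : Pt n := fun e => t (j e) e

/-- The index vector of slot `i` after the action of `g`. [this work] -/
def gidx (g : Sym 3) (i : Fin 3) : J := fun e => g e i

/-- The action is definitionally a re-indexing of the box. [this work] -/
theorem act_eq_pt (g : Sym 3) (t : Fin 3 → Pt n) (i : Fin 3) : act g t i = pt t (gidx g i) := rfl

/-- Points of updated index vectors are updated points. [this work] -/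
theorem pt_update (t : Fin 3 → Pt n) (j : J) (e : Fin 3) (i : Fin 3) :
    pt t (Function.update j e i) = Function.update (pt t j) e (t i e) := by
  funext e'
  by_cases h : e' = e
  · subst h; simp [pt]
  · simp [pt, Function.update_of_ne h]

/-- A LOCAL DATUM: bottom / kernel indicators, label-equality and transfer relations on index vectors. [this work] -/
structure LocalDatum where
  /-- `Z j`: the point with index `j` is a bottom point -/
  Z : J → Bool
  /-- `O j`: the point with index `j` is a kernel point -/
  O : J → Bool
  /-- `E j j'`: the two points carry the same label -/
  E : J → J → Bool
  /-- `M j j'`: the pair of points is in the transfer set `Λ_T` -/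
  M : J → J → Bool

/-- The CELL CODE of an index vector in a local datum: `0` bottom, `2` kernel, `1` otherwise (petal). [this work] -/
def LocalDatum.cell (D : LocalDatum) (j : J) : Fin 3 := if D.Z j = true then 0 else if D.O j = true then 2 else 1

/-- The abstract pole-`T` symmetric kernel on index vectors (cell form). [this work] -/
def LocalDatum.kT (D : LocalDatum) (x y z : J) : ℤ :=
  6 * (if D.cell x = 2 ∧ D.cell y = 2 ∧ D.cell z = 0 then 1 else 0)
    - 3 * (if D.cell x = 2 ∧ D.cell y = 1 ∧ D.cell z = 1 ∧ D.E y z = false then 1 else 0)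
    - (if D.cell x = 1 ∧ D.cell y = 1 ∧ D.cell z = 1 ∧ D.E x y = false ∧ D.E x z = false ∧ D.E y z = false then 1 else 0)
    - 6 * ((if D.M x y = true then 1 else 0) * ((if D.cell z = 2 then 1 else 0) - (if D.cell z = 0 then 1 else 0)))

/-- The abstract orbit sum `F_loc(D) = Σ_{g ∈ S₃³} kT(g·0, g·1, g·2)`. [this work] -/
def LocalDatum.FlocT (D : LocalDatum) : ℤ := ∑ g : Sym 3, D.kT (gidx g 0) (gidx g 1) (gidx g 2)

/-- The local datum of a labelling at a triple. [this work] -/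
def datum (lab : Pt n → ℕ) (t : Fin 3 → Pt n) : LocalDatum where
  Z j := decide (lab (pt t j) = 0)
  O j := decide (lab (pt t j) = 1)
  E j j' := decide (lab (pt t j) = lab (pt t j'))
  M j j' := decide (LamT lab (pt t j) (pt t j'))

/-- Cell code `2` of the datum of a labelling = kernel point. [this work] -/
theorem datum_cell_eq_two (lab : Pt n → ℕ) (t : Fin 3 → Pt n) (j : J) : (datum lab t).cell j = 2 ↔ lab (pt t j) = 1 := by
  unfold LocalDatum.cell datum; simp only [decide_eq_true_eq]; split_ifs with h1 h2 <;> simp <;> omega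

/-- Cell code `0` of the datum of a labelling = bottom point. [this work] -/
theorem datum_cell_eq_zero (lab : Pt n → ℕ) (t : Fin 3 → Pt n) (j : J) : (datum lab t).cell j = 0 ↔ lab (pt t j) = 0 := by
  unfold LocalDatum.cell datum; simp only [decide_eq_true_eq]; split_ifs with h1 h2 <;> simp <;> omega

/-- Cell code `1` of the datum of a labelling = petal point. [this work] -/
theorem datum_cell_eq_one (lab : Pt n → ℕ) (t : Fin 3 → Pt n) (j : J) : (datum lab t).cell j = 1 ↔ 2 ≤ lab (pt t j) := by
  unfold LocalDatum.cell datum; simp only [decide_eq_true_eq]; split_ifs with h1 h2 <;> simp <;> omega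

/-- Label (in)equality in the datum of a labelling. [this work] -/
theorem datum_E_eq_false (lab : Pt n → ℕ) (t : Fin 3 → Pt n) (j j' : J) :
    (datum lab t).E j j' = false ↔ lab (pt t j) ≠ lab (pt t j') := by
  simp [datum]

/-- Transfer pairs in the datum of a labelling. [this work] -/
theorem datum_M_eq_true (lab : Pt n → ℕ) (t : Fin 3 → Pt n) (j j' : J) :
    (datum lab t).M j j' = true ↔ LamT lab (pt t j) (pt t j') := by
  simp [datum]

/-- **Soundness of the abstraction**: the orbit sum of the symmetric pole-`T` kernel at `t` IS the abstract orbit sum of the local datum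
of `t`. [this work] -/
theorem orbitSum_kerSym_eq_FlocT (lab : Pt n → ℕ) (t : Fin 3 → Pt n) :
    orbitSum (fun s => kerSym 1 0 lab (mT lab) (s 0) (s 1) (s 2)) t = (datum lab t).FlocT := by
  unfold orbitSum LocalDatum.FlocT
  refine Finset.sum_congr rfl fun g _ => ?_
  simp only [act_eq_pt, kerSym, LocalDatum.kT, mT, datum_cell_eq_two, datum_cell_eq_zero, datum_cell_eq_one, datum_E_eq_false,
    datum_M_eq_true, ne_eq]
  push_cast
  rfl

/-! ### The comparison data of a triple and the validity constraints -/

/-- Per-block comparison data of a triple: `preOf t e i i' ↔ t i e ≤ t i' e` (a total preorder on the three slots). [this work] -/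
def preOf (t : Fin 3 → Pt n) (e : Fin 3) (i i' : Fin 3) : Bool := decide (t i e ≤ t i' e)

/-- Index of a slot carrying the MEDIAN of three values, from comparison data. [this work] -/
def medSel (le : Fin 3 → Fin 3 → Bool) (a b c : Fin 3) : Fin 3 :=
  if le a b = true then (if le b c = true then b else (if le a c = true then c else a))
  else (if le a c = true then a else (if le b c = true then c else b))

/-- Index of a slot carrying the MAXIMUM of three values, from comparison data. [this work] -/
def maxSel (le : Fin 3 → Fin 3 → Bool) (a b c : Fin 3) : Fin 3 :=
  if le a b = true then (if le b c = true then c else b) else (if le a c = true then c else a)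

/-- Blockwise median index vector of three index vectors. [this work] -/
def medIdx (pre : Fin 3 → Fin 3 → Fin 3 → Bool) (j₁ j₂ j₃ : J) : J := fun e => medSel (pre e) (j₁ e) (j₂ e) (j₃ e)

/-- Blockwise maximum index vector of three index vectors. [this work] -/
def joinIdx (pre : Fin 3 → Fin 3 → Fin 3 → Bool) (j₁ j₂ j₃ : J) : J := fun e => maxSel (pre e) (j₁ e) (j₂ e) (j₃ e)

/-- `medSel` selects the median value. [this work] -/
theorem medSel_spec (t : Fin 3 → Pt n) (e : Fin 3) (a b c : Fin 3) :
    (t (medSel (preOf t e) a b c) e : ℕ) = max (min (t a e : ℕ) (t b e)) (min (max (t a e : ℕ) (t b e)) (t c e)) := by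
  unfold medSel preOf
  simp only [decide_eq_true_eq]
  split_ifs with h1 h2 h3 h4 h5 <;> simp only [Fin.le_def, not_le] at * <;> omega

/-- `maxSel` selects the maximum value. [this work] -/
theorem maxSel_spec (t : Fin 3 → Pt n) (e : Fin 3) (a b c : Fin 3) :
    (t (maxSel (preOf t e) a b c) e : ℕ) = max (max (t a e : ℕ) (t b e)) (t c e) := by
  unfold maxSel preOf
  simp only [decide_eq_true_eq]
  split_ifs with h1 h2 h3 <;> simp only [Fin.le_def, not_le] at * <;> omega

/-- The triple of points indexed by three index vectors. [this work] -/
def tri (t : Fin 3 → Pt n) (j₁ j₂ j₃ : J) : Fin 3 → Pt n := ![pt t j₁, pt t j₂, pt t j₃]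

/-- The median of the indexed triple is the point of the median index vector. [this work] -/
theorem med_tri (t : Fin 3 → Pt n) (j₁ j₂ j₃ : J) : med (tri t j₁ j₂ j₃) = pt t (medIdx (preOf t) j₁ j₂ j₃) := by
  funext e
  apply Fin.ext
  rw [show (pt t (medIdx (preOf t) j₁ j₂ j₃) e) = t (medSel (preOf t e) (j₁ e) (j₂ e) (j₃ e)) e from rfl, medSel_spec]
  simp [med, tri, pt, Fin.coe_max, Fin.coe_min]

/-- The join of the indexed triple is the point of the maximum index vector. [this work] -/
theorem join_tri (t : Fin 3 → Pt n) (j₁ j₂ j₃ : J) : join (tri t j₁ j₂ j₃) = pt t (joinIdx (preOf t) j₁ j₂ j₃) := by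
  funext e
  apply Fin.ext
  rw [show (pt t (joinIdx (preOf t) j₁ j₂ j₃) e) = t (maxSel (preOf t e) (j₁ e) (j₂ e) (j₃ e)) e from rfl, maxSel_spec]
  simp [join, tri, pt, Fin.coe_max]

/-- VALIDITY of a local datum relative to comparison data: the finitely many constraints that the local datum of a monotone labelling at a
triple satisfies (monotonicity, and the consequences of the three-block structure lemma for the transfer pairs). [this work] -/
structure LocalDatum.Valid (pre : Fin 3 → Fin 3 → Fin 3 → Bool) (D : LocalDatum) : Prop where
  /-- comparisons are total -/
  total : ∀ e i i', pre e i i' = true ∨ pre e i' i = true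
  /-- comparisons are transitive -/
  trans : ∀ e i i' i'', pre e i i' = true → pre e i' i'' = true → pre e i i'' = true
  /-- no point is both bottom and kernel -/
  Z_O : ∀ j, ¬ (D.Z j = true ∧ D.O j = true)
  /-- label equality is reflexive -/
  E_refl : ∀ j, D.E j j = true
  /-- label equality is symmetric -/
  E_symm : ∀ j j', D.E j j' = true → D.E j' j = true
  /-- label equality is transitive -/
  E_trans : ∀ j j' j'', D.E j j' = true → D.E j' j'' = true → D.E j j'' = true
  /-- equal labels have equal bottom status -/
  E_Z : ∀ j j', D.E j j' = true → (D.Z j = true ↔ D.Z j' = true)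
  /-- equal labels have equal kernel status -/
  E_O : ∀ j j', D.E j j' = true → (D.O j = true ↔ D.O j' = true)
  /-- monotonicity of the labelling -/
  mono : ∀ j j', (∀ e, pre e (j e) (j' e) = true) → D.E j j' = true ∨ D.Z j = true ∨ D.O j' = true
  /-- index vectors denoting the same point have the same transfer pairs -/
  M_congr : ∀ j j', (∀ e, pre e (j e) (j' e) = true ∧ pre e (j' e) (j e) = true) →
    ∀ j'', D.M j j'' = D.M j' j'' ∧ D.M j'' j = D.M j'' j'
  /-- a transfer pair starts at a bottom point -/
  M_Z : ∀ j j', D.M j j' = true → D.Z j = true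
  /-- a transfer pair ends at a kernel point -/
  M_O : ∀ j j', D.M j j' = true → D.O j' = true
  /-- a transfer pair is strictly increasing in every block -/
  M_lt : ∀ j j', D.M j j' = true → ∀ e, pre e (j e) (j' e) = true ∧ pre e (j' e) (j e) = false
  /-- one-block lifts of a transfer pair are not bottom points -/
  M_lift1 : ∀ j j', D.M j j' = true → ∀ e, D.Z (Function.update j e (j' e)) = false
  /-- one-block lifts of a transfer pair that are petal points lie in distinct petals -/
  M_lift1_ne : ∀ j j', D.M j j' = true → ∀ e e', e ≠ e' →
    D.O (Function.update j e (j' e)) = false → D.O (Function.update j e' (j' e')) = false →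
    D.E (Function.update j e (j' e)) (Function.update j e' (j' e')) = false
  /-- two-block lifts of a transfer pair are kernel points -/
  M_lift2 : ∀ j j', D.M j j' = true → ∀ e, D.O (Function.update j' e (j e)) = true
  /-- every LOCAL rainbow with a bottom median yields a transfer pair -/
  M_loc : ∀ j₁ j₂ j₃, D.Z j₁ = false → D.O j₁ = false → D.Z j₂ = false → D.O j₂ = false → D.Z j₃ = false → D.O j₃ = false →
    D.E j₁ j₂ = false → D.E j₁ j₃ = false → D.E j₂ j₃ = false →
    D.Z (medIdx pre j₁ j₂ j₃) = true → D.M (medIdx pre j₁ j₂ j₃) (joinIdx pre j₁ j₂ j₃) = true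

/-- Petal labels of a rainbow are pairwise distinct (index form). [this work] -/
theorem IsRainbow.ne {lab : Pt n → ℕ} {u : Fin 3 → Pt n} (hu : IsRainbow lab u) {i i' : Fin 3} (h : i ≠ i') :
    lab (u i) ≠ lab (u i') := by
  obtain ⟨-, h01, h02, h12⟩ := hu
  fin_cases i <;> fin_cases i' <;> first
    | exact absurd rfl h
    | exact h01
    | exact h01.symm
    | exact h02
    | exact h02.symm
    | exact h12
    | exact h12.symm

/-- **The local datum of a monotone labelling at any triple is valid.** [this work] -/
theorem datum_valid {lab : Pt n → ℕ} (hlab : IsMono lab) (t : Fin 3 → Pt n) : (datum lab t).Valid (preOf t) where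
  total e i i' := by
    simp only [preOf, decide_eq_true_eq]; exact le_total _ _
  trans e i i' i'' h1 h2 := by
    simp only [preOf, decide_eq_true_eq] at *; exact le_trans h1 h2
  Z_O j := by
    simp only [datum, decide_eq_true_eq]; omega
  E_refl j := by simp [datum]
  E_symm j j' h := by
    simp only [datum, decide_eq_true_eq] at *; exact h.symm
  E_trans j j' j'' h1 h2 := by
    simp only [datum, decide_eq_true_eq] at *; exact h1.trans h2
  E_Z j j' h := by
    simp only [datum, decide_eq_true_eq] at *; omega
  E_O j j' h := by
    simp only [datum, decide_eq_true_eq] at *; omega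
  mono j j' h := by
    simp only [datum, preOf, decide_eq_true_eq] at *
    exact hlab (fun e => h e)
  M_congr j j' h j'' := by
    have hpt : pt t j = pt t j' := by
      funext e
      have h1 := (h e).1; have h2 := (h e).2
      simp only [preOf, decide_eq_true_eq] at h1 h2
      exact le_antisymm h1 h2
    simp only [datum, hpt, and_self]
  M_Z j j' h := by
    simp only [datum, decide_eq_true_eq] at *; exact h.1
  M_O j j' h := by
    simp only [datum, decide_eq_true_eq] at *
    obtain ⟨h0, u, hu, hmed, hjoin⟩ := h
    rw [← hjoin]; exact lab_join hlab hu (hmed ▸ h0)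
  M_lt j j' h e := by
    simp only [datum, decide_eq_true_eq] at h
    obtain ⟨h0, u, hu, hmed, hjoin⟩ := h
    have hlt := med_lt_join hlab hu (hmed ▸ h0) e
    rw [hmed, hjoin] at hlt
    simp only [pt] at hlt
    simp only [preOf, decide_eq_true_eq, decide_eq_false_iff_not, not_le]
    exact ⟨le_of_lt hlt, hlt⟩
  M_lift1 j j' h e := by
    simp only [datum, decide_eq_true_eq, decide_eq_false_iff_not] at h ⊢
    obtain ⟨h0, u, hu, hmed, hjoin⟩ := h
    obtain ⟨i, hi⟩ := (three_block_structure hlab hu (hmed ▸ h0)).1 e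
    have hl : lift1 u e = pt t (Function.update j e (j' e)) := by
      rw [pt_update, lift1, hmed, hjoin]; rfl
    have := lab_lift1 hlab hu (hmed ▸ h0) hi
    rw [hl] at this
    have h2 := hu.1 i
    omega
  M_lift1_ne j j' h e e' hne hO hO' := by
    simp only [datum, decide_eq_true_eq, decide_eq_false_iff_not] at h hO hO' ⊢
    obtain ⟨h0, u, hu, hmed, hjoin⟩ := h
    have hs := three_block_structure hlab hu (hmed ▸ h0)
    obtain ⟨i, hi⟩ := hs.1 e
    obtain ⟨i', hi'⟩ := hs.1 e'
    have hii' : i ≠ i' := by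
      rintro rfl; exact hne (hs.2 i e e' hi hi')
    have hl : lift1 u e = pt t (Function.update j e (j' e)) := by
      rw [pt_update, lift1, hmed, hjoin]; rfl
    have hl' : lift1 u e' = pt t (Function.update j e' (j' e')) := by
      rw [pt_update, lift1, hmed, hjoin]; rfl
    have h1 := lab_lift1 hlab hu (hmed ▸ h0) hi
    have h1' := lab_lift1 hlab hu (hmed ▸ h0) hi'
    rw [hl] at h1; rw [hl'] at h1'
    rcases h1 with h1 | h1
    · rcases h1' with h1' | h1'
      · rw [h1, h1']; exact hu.ne hii'
      · exact absurd h1' hO'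
    · exact absurd h1 hO
  M_lift2 j j' h e := by
    simp only [datum, decide_eq_true_eq] at h ⊢
    obtain ⟨h0, u, hu, hmed, hjoin⟩ := h
    have hl : lift2 u e = pt t (Function.update j' e (j e)) := by
      rw [pt_update, lift2, hmed, hjoin]; rfl
    have := lab_lift2 hlab hu (hmed ▸ h0) e
    rw [hl] at this; exact this
  M_loc j₁ j₂ j₃ hz1 ho1 hz2 ho2 hz3 ho3 h12 h13 h23 hzm := by
    simp only [datum, decide_eq_true_eq, decide_eq_false_iff_not] at *
    refine ⟨hzm, tri t j₁ j₂ j₃, ?_, med_tri t j₁ j₂ j₃, join_tri t j₁ j₂ j₃⟩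
    refine ⟨?_, ?_, ?_, ?_⟩
    · intro i; fin_cases i <;> simp [tri] <;> omega
    · simpa [tri] using h12
    · simpa [tri] using h13
    · simpa [tri] using h23

/-- **Reduction of the three-block certificate to a finite statement.**  If every local datum valid for some comparison data has a
nonnegative abstract orbit sum, then `ThreeBlockMedianCertificate` holds. [this work] -/
theorem threeBlockMedianCertificate_of_local
    (h : ∀ (pre : Fin 3 → Fin 3 → Fin 3 → Bool) (D : LocalDatum), D.Valid pre → 0 ≤ D.FlocT) :
    ThreeBlockMedianCertificate := by
  apply threeBlockMedianCertificate_of_poleT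
  intro n lab hlab t
  have h6 := orbitSum_kerSym 1 0 lab (mT lab) t
  have hF := orbitSum_kerSym_eq_FlocT lab t
  have hv := h (preOf t) (datum lab t) (datum_valid hlab t)
  rw [← hF, h6] at hv
  linarith
end LocalAbstraction

end ChainCert

end Summit.CriticalPhenomena.PercolationContinuityZ3.Theorems.SunflowerPartition
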